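import Literature.NumberTheory.LFunctions.NymanBeurlingRateSmallOrdinates
import Literature.NumberTheory.LFunctions.NymanBeurlingRateJ
import Literature.NumberTheory.LFunctions.ZetaCriticalLineWeightedMeanSquare
import HarnessLib

/-!
# Balazard–de Roton 2010, Théorème 1 from their Proposition 10 alone (no critical-line bound)

Topic `Literature/NumberTheory/LFunctions`; a brick of the proof of Balazard–de Roton 2010,
Théorème 1 (`Literature.NumberTheory.LFunctions.BalazardDeRoton2010_thm1`, `NymanBeurlingRate.lean`):
M. Balazard, A. de Roton, *Sur un critère de Báez-Duarte pour l'hypothèse de Riemann*, Int. J. Number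
Theory 6 (2010) 883–903 = arXiv:0812.1689. Everything here is PROVED; there are no definitions and no
new named facts.

The tree reduces Théorème 1 to Propositions 2 and 3
(`Literature.NumberTheory.LFunctions.BalazardDeRoton.BalazardDeRoton2010_thm1_of_props`,
`NymanBeurlingRateReduction.lean`), proves Proposition 2 (`…BalazardDeRoton.exists_lintegral_jIntegrand_le`,
`NymanBeurlingRateJ.lean`) and Proposition 13 (`…BalazardDeRoton.exists_lintegral_iIntegrand_tail_le`,
`NymanBeurlingRateLargeOrdinates.lean`), and obtains Proposition 3 from TWO deep pointwise inputs
(`…BalazardDeRoton.iBound_of_pointwise`, `NymanBeurlingRateSmallOrdinates.lean`): the paper's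
Proposition 10 (Soundararajan's method) and Titchmarsh's (14.14.1),
`|ζ(1/2+iτ)|² ≪ (1+|τ|)^{β(τ)}` under RH, "both still to be proved in the tree".

This file removes the second input. In Proposition 14 the pointwise bound for `|ζ(1/2+it)|²` is
only integrated against `|ζ(s+ε)⁻¹ − M_N(s+ε)|²/|s|² ≪ N^{-ε/2}(1+|τ|)^{1−2β(τ)}/|s|² ≤ 8N^{-ε/2}/(1+|τ|)`,
so the PROVED weighted mean square `∫_{-T}^{T} |ζ(1/2+it)|² dt/(1+|t|) ≪ log³ T`
(`Literature.NumberTheory.LFunctions.exists_integral_norm_sq_zeta_half_div_le_symm`,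
`ZetaCriticalLineWeightedMeanSquare.lean`, from the approximate functional equation and the crude
mean value theorem) suffices, at the price of a factor `log³ N`:
`∫_{|τ|<N^{3/4}} |ζ(s)|²|M_N(s+ε) − ζ(s+ε)⁻¹|² dτ/|s|² ≪ N^{-ε/2} log³ N`
(`lintegral_iIntegrand_small_le_of_prop10`; the source: `≪ N^{-ε/2}`). With
`ε = ε_N = 25(log log N)^{5/2+δ}(log N)^{-1/2}` one has `N^{-ε_N/2}log³N ≤ ε_N/25` and
`N^{-3/8} ≤ N^{-1/8}log²N ≤ 12288 ε_N/25` for `N ≥ 16` (`rate_facts_of_sixteen_le`), so the paper's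
final step ("Le choix `ε = 25(log log N)^{5/2+δ}(log N)^{-1/2}` donne le théorème", p. 3) goes
through unchanged (with the paper's `25` replaced by any `A > 0`): **Théorème 1 follows from
Proposition 10 alone** (`Literature.NumberTheory.LFunctions.BalazardDeRoton2010_thm1_of_prop10`, with
Proposition 10 an explicit HYPOTHESIS in exactly the shape `hP10` of `BalazardDeRoton.iBound_of_pointwise`
— Soundararajan's method for `M(x)` and the twisted sums `M_N(iτ)`, paper §§5–6, is not in the tree).

## Main results

* `BalazardDeRoton.exists_lintegral_iIntegrand_small_le_of_pointwise` — Prop. 14 with `log³N` loss, from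
  the pointwise conclusion of Prop. 10 and the mean square of `ζ` (no bound for `ζ(1/2+it)` needed).
* `BalazardDeRoton.rate_facts_of_sixteen_le` — `N^{-ε_N/2}(1+log N)³ ≤ C_A ε_N`, `N^{-3/8} ≤ (12288/A)ε_N`
  (`N ≥ 16`, `ε_N = A(log log N)^p(log N)^{-1/2}`).
* `BalazardDeRoton2010_thm1_of_prop10` — Théorème 1 from the hypothesis `hP10` (Prop. 10) alone.

## References

* [BalazardDeRoton2010] M. Balazard, A. de Roton, Int. J. Number Theory 6 (2010) 883–903, Théorème 1,
  §2 (Props. 1–3 and the choice of `ε`), §6 Prop. 10, §7 Props. 13–14 (arXiv:0812.1689 pp. 2–3, 7,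
  10–11).
* [Titchmarsh1986] E. C. Titchmarsh, *The Theory of the Riemann Zeta-Function*, 2nd ed., Thm. 7.3
  (mean square, weak form used) and (14.14.1) (the input avoided).
-/

noncomputable section

open Complex Filter Topology Set MeasureTheory
open scoped Real ENNReal

namespace Literature.NumberTheory.LFunctions

namespace BalazardDeRoton

open BaezDuarteOnlyIf

/-! ### The `I`-integrand: continuity and the pointwise consequence of Proposition 10 -/

/-- `iIntegrand N ε τ = |ζ(1/2+iτ)|²|ζ(1/2+ε+iτ)⁻¹ − M_N(1/2+ε+iτ)|²/(1/4+τ²)`. [folklore] -/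
theorem iIntegrand_eq_div (N : ℕ) (ε τ : ℝ) :
    iIntegrand N ε τ = ‖riemannZeta (1 / 2 + τ * I)‖ ^ 2 *
      ‖(riemannZeta (1 / 2 + ε + τ * I))⁻¹ - moebiusSum N (1 / 2 + ε + τ * I)‖ ^ 2 / (1 / 4 + τ ^ 2) := by
  rw [iIntegrand, norm_sub_rev, norm_sq_half_add]

/-- Continuity of `τ ↦ ζ(a + iτ)` for `Re a ≠ 1`. [folklore] -/
theorem continuous_zeta_vertical {a : ℂ} (ha : a.re ≠ 1) :
    Continuous fun τ : ℝ ↦ riemannZeta (a + τ * I) := by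
  have hc : ContinuousOn riemannZeta {1}ᶜ := fun s hs ↦
    (differentiableAt_riemannZeta hs).continuousAt.continuousWithinAt
  refine hc.comp_continuous (by fun_prop) fun τ h ↦ ?_
  have := congrArg Complex.re (h : a + τ * I = 1)
  simp at this
  exact ha this

/-- Continuity of `iIntegrand N ε` (RH: `ζ(1/2+ε+iτ) ≠ 0`; `0 < ε ≤ 1/4`). [folklore] -/
theorem continuous_iIntegrand (hRH : RiemannHypothesis) (N : ℕ) {ε : ℝ} (hε0 : 0 < ε) (hε1 : ε ≤ 1 / 4) :
    Continuous (iIntegrand N ε) := by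
  have hn : Continuous fun τ : ℝ ↦ riemannZeta (1 / 2 + τ * I) :=
    continuous_zeta_vertical (a := 1 / 2) (by norm_num)
  have hd : Continuous fun τ : ℝ ↦ riemannZeta (1 / 2 + ε + τ * I) :=
    continuous_zeta_vertical (a := 1 / 2 + ε) (by simp; linarith)
  have hne : ∀ τ : ℝ, riemannZeta (1 / 2 + ε + τ * I) ≠ 0 := fun τ ↦
    InvZetaRH.riemannZeta_ne_zero_of_RH hRH (by simp; linarith)
  have hM : Continuous fun τ : ℝ ↦ moebiusSum N (1 / 2 + ε + τ * I) := by
    unfold moebiusSum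
    refine continuous_finsetSum _ fun a ha ↦ ?_
    have ha0 : (a : ℂ) ≠ 0 := by
      have : 1 ≤ a := (Finset.mem_Icc.1 ha).1
      exact_mod_cast (by omega : a ≠ 0)
    exact continuous_const.div (Continuous.const_cpow (by fun_prop) (Or.inl ha0))
      fun τ ↦ cpow_ne_zero_iff.2 (Or.inl ha0)
  have e : iIntegrand N ε = fun τ : ℝ ↦ ‖riemannZeta (1 / 2 + τ * I)‖ ^ 2 *
      ‖(riemannZeta (1 / 2 + ε + τ * I))⁻¹ - moebiusSum N (1 / 2 + ε + τ * I)‖ ^ 2 / (1 / 4 + τ ^ 2) := by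
    funext τ
    exact iIntegrand_eq_div N ε τ
  rw [e]
  refine ((hn.norm.pow 2).mul (((hd.inv₀ hne).sub hM).norm.pow 2)).div (by fun_prop)
    fun τ ↦ by positivity

/-- `(1+|τ|)/(1/4+τ²) ≤ 8/(1+|τ|)`. [folklore] -/
theorem one_add_abs_div_quarter_add_sq_le (τ : ℝ) : (1 + |τ|) / (1 / 4 + τ ^ 2) ≤ 8 / (1 + |τ|) := by
  have h0 : 0 < 1 + |τ| := by positivity
  have h1 : (0 : ℝ) < 1 / 4 + τ ^ 2 := by positivity
  rw [div_le_div_iff₀ h1 h0]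
  nlinarith [sq_abs τ, abs_nonneg τ]

/-! ### Proposition 14 with a `log³ N` loss, from Proposition 10 and the mean square of `ζ` -/

/-- **Proposition 14, averaged form (RH + the pointwise conclusion of Proposition 10)**: there is
`C₀` such that for `N ≥ 1`, `0 < ε ≤ 1/4`, `K ≥ 0` and
`|ζ(1/2+ε+iτ)⁻¹ − M_N(1/2+ε+iτ)| ≤ K N^{-ε/4}(1+|τ|)^{1/2−β(τ)}` on `|τ| ≤ N^{3/4}`,
`∫_{|τ| < N^{3/4}} |ζ(s)|²|M_N(s+ε) − ζ(s+ε)⁻¹|² dτ/|s|² ≤ C₀ K² N^{-ε/2}(1 + log N)³` (`s = 1/2+iτ`;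
the source has `≪ N^{-ε/2}` via Titchmarsh (14.14.1); here the mean square of `ζ` is used instead).
[cite: BalazardDeRoton2010, Prop. 14] -/
theorem exists_lintegral_iIntegrand_small_le_of_pointwise (hRH : RiemannHypothesis) :
    ∃ C₀ : ℝ, 0 < C₀ ∧ ∀ (K : ℝ), 0 ≤ K → ∀ N : ℕ, 1 ≤ N → ∀ ε : ℝ, 0 < ε → ε ≤ 1 / 4 →
      (∀ τ : ℝ, |τ| ≤ (N : ℝ) ^ (3 / 4 : ℝ) →
        ‖(riemannZeta (1 / 2 + ε + τ * I))⁻¹ - moebiusSum N (1 / 2 + ε + τ * I)‖ ≤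
          K * (N : ℝ) ^ (-ε / 4) * (1 + |τ|) ^ (1 / 2 - betaExp τ)) →
        ∫⁻ τ in {τ : ℝ | |τ| < (N : ℝ) ^ (3 / 4 : ℝ)}, ENNReal.ofReal (iIntegrand N ε τ) ≤
          ENNReal.ofReal (C₀ * K ^ 2 * (N : ℝ) ^ (-ε / 2) * (1 + Real.log N) ^ 3) := by
  obtain ⟨C_M, hC_M, hMS⟩ := exists_integral_norm_sq_zeta_half_div_le_symm
  refine ⟨8 * C_M, by positivity, fun C hC0 N hN1 ε hε0 hε1 hb ↦ ?_⟩
  have hNpos : (0 : ℝ) < N := by exact_mod_cast hN1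
  have hN1' : (1 : ℝ) ≤ N := by exact_mod_cast hN1
  set T : ℝ := (N : ℝ) ^ (3 / 4 : ℝ) with hT
  have hT1 : 1 ≤ T := Real.one_le_rpow hN1' (by norm_num)
  have hT0 : 0 ≤ T := by linarith
  have hlogN : 0 ≤ Real.log N := Real.log_nonneg hN1'
  have hlogT : Real.log T ≤ Real.log N := by
    rw [hT, Real.log_rpow hNpos]; nlinarith
  set B : ℝ → ℝ := iIntegrand N ε with hB
  have hBc : Continuous B := continuous_iIntegrand hRH N hε0 hε1
  have hB0 : ∀ τ, 0 ≤ B τ := fun τ ↦ iIntegrand_nonneg N ε τ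
  set g : ℝ → ℝ := fun τ ↦ ‖riemannZeta (1 / 2 + τ * I)‖ ^ 2 / (1 + |τ|) with hg
  have hgc : Continuous g := continuous_norm_sq_zeta_half_div
  set A : ℝ := 8 * C ^ 2 * (N : ℝ) ^ (-ε / 2) with hA
  have hA0 : 0 ≤ A := by positivity
  -- pointwise bound on `[-T, T]` from Proposition 10
  have hpt : ∀ τ ∈ Icc (-T) T, B τ ≤ A * g τ := by
    intro τ hτ
    have hτabs : |τ| ≤ T := abs_le.2 ⟨hτ.1, hτ.2⟩
    have h1 := hb τ hτabs
    have hu0 : 0 < 1 + |τ| := by positivity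
    have hβ := (betaExp_nonneg_le τ).1
    have hE : ‖(riemannZeta (1 / 2 + ε + τ * I))⁻¹ - moebiusSum N (1 / 2 + ε + τ * I)‖ ≤
        C * (N : ℝ) ^ (-ε / 4) * (1 + |τ|) ^ (1 / 2 : ℝ) := by
      refine h1.trans ?_
      have hr : (1 + |τ|) ^ (1 / 2 - betaExp τ) ≤ (1 + |τ|) ^ (1 / 2 : ℝ) :=
        Real.rpow_le_rpow_of_exponent_le (by linarith [abs_nonneg τ]) (by linarith)
      exact mul_le_mul_of_nonneg_left hr (by positivity)
    have hE2 : ‖(riemannZeta (1 / 2 + ε + τ * I))⁻¹ - moebiusSum N (1 / 2 + ε + τ * I)‖ ^ 2 ≤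
        C ^ 2 * (N : ℝ) ^ (-ε / 2) * (1 + |τ|) := by
      have h0 : 0 ≤ ‖(riemannZeta (1 / 2 + ε + τ * I))⁻¹ - moebiusSum N (1 / 2 + ε + τ * I)‖ := norm_nonneg _
      calc ‖(riemannZeta (1 / 2 + ε + τ * I))⁻¹ - moebiusSum N (1 / 2 + ε + τ * I)‖ ^ 2
          ≤ (C * (N : ℝ) ^ (-ε / 4) * (1 + |τ|) ^ (1 / 2 : ℝ)) ^ 2 := pow_le_pow_left₀ h0 hE 2
        _ = C ^ 2 * ((N : ℝ) ^ (-ε / 4)) ^ 2 * ((1 + |τ|) ^ (1 / 2 : ℝ)) ^ 2 := by ring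
        _ = C ^ 2 * (N : ℝ) ^ (-ε / 2) * (1 + |τ|) := by
            congr 2
            · rw [← Real.rpow_natCast, ← Real.rpow_mul hNpos.le]; norm_num; ring_nf
            · rw [← Real.rpow_natCast, ← Real.rpow_mul hu0.le]; norm_num
    have hw : (0 : ℝ) < 1 / 4 + τ ^ 2 := by positivity
    rw [hB, hg]; simp only
    rw [iIntegrand_eq_div]
    calc ‖riemannZeta (1 / 2 + τ * I)‖ ^ 2 *
          ‖(riemannZeta (1 / 2 + ε + τ * I))⁻¹ - moebiusSum N (1 / 2 + ε + τ * I)‖ ^ 2 / (1 / 4 + τ ^ 2)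
        ≤ ‖riemannZeta (1 / 2 + τ * I)‖ ^ 2 * (C ^ 2 * (N : ℝ) ^ (-ε / 2) * (1 + |τ|)) / (1 / 4 + τ ^ 2) := by
          gcongr
      _ = C ^ 2 * (N : ℝ) ^ (-ε / 2) * ‖riemannZeta (1 / 2 + τ * I)‖ ^ 2 * ((1 + |τ|) / (1 / 4 + τ ^ 2)) := by
          ring
      _ ≤ C ^ 2 * (N : ℝ) ^ (-ε / 2) * ‖riemannZeta (1 / 2 + τ * I)‖ ^ 2 * (8 / (1 + |τ|)) :=
          mul_le_mul_of_nonneg_left (one_add_abs_div_quarter_add_sq_le τ) (by positivity)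
      _ = A * (‖riemannZeta (1 / 2 + τ * I)‖ ^ 2 / (1 + |τ|)) := by rw [hA]; ring
  -- integrate over `[-T, T] ⊇ {|τ| < T}`
  have hsub : {τ : ℝ | |τ| < T} ⊆ Icc (-T) T := fun τ hτ ↦ by
    have h := abs_lt.1 (show |τ| < T from hτ); exact ⟨h.1.le, h.2.le⟩
  have hBint : IntegrableOn B (Icc (-T) T) := hBc.integrableOn_Icc
  have hgint : IntegrableOn (fun τ ↦ A * g τ) (Icc (-T) T) := (hgc.const_mul A).integrableOn_Icc
  have hTT : -T ≤ T := by linarith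
  have hreal : ∫ τ in Icc (-T) T, B τ ≤ A * (C_M * (1 + Real.log N) ^ 3) := by
    calc ∫ τ in Icc (-T) T, B τ ≤ ∫ τ in Icc (-T) T, A * g τ :=
          setIntegral_mono_on hBint hgint measurableSet_Icc hpt
      _ = A * ∫ τ in (-T)..T, g τ := by
          rw [integral_Icc_eq_integral_Ioc, ← intervalIntegral.integral_of_le hTT, intervalIntegral.integral_const_mul]
      _ ≤ A * (C_M * (1 + Real.log T) ^ 3) := mul_le_mul_of_nonneg_left (hMS T hT1) hA0
      _ ≤ A * (C_M * (1 + Real.log N) ^ 3) := by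
          have hlT0 : 0 ≤ Real.log T := Real.log_nonneg hT1
          gcongr
  calc ∫⁻ τ in {τ : ℝ | |τ| < T}, ENNReal.ofReal (B τ) ≤ ∫⁻ τ in Icc (-T) T, ENNReal.ofReal (B τ) :=
        lintegral_mono_set hsub
    _ = ENNReal.ofReal (∫ τ in Icc (-T) T, B τ) :=
        (ofReal_integral_eq_lintegral_ofReal hBint (ae_of_all _ fun τ ↦ hB0 τ)).symm
    _ ≤ ENNReal.ofReal (8 * C_M * C ^ 2 * (N : ℝ) ^ (-ε / 2) * (1 + Real.log N) ^ 3) := by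
        refine ENNReal.ofReal_le_ofReal (hreal.trans (le_of_eq ?_))
        rw [hA]; ring

/-! ### The final step: the choice `ε = 25 (log log N)^{5/2+δ} (log N)^{-1/2}` -/

/-- `e^{-u/8}(1+u)² ≤ 12288/u` for `u ≥ 1` (`e^{y} ≥ y³/3!`). [folklore] -/
theorem exp_neg_div_eight_mul_one_add_sq_le {u : ℝ} (hu : 1 ≤ u) :
    Real.exp (-(u / 8)) * (1 + u) ^ 2 ≤ 12288 * u⁻¹ := by
  have hu0 : 0 < u := by linarith
  have h := Real.pow_div_factorial_le_exp (u / 8) (by positivity) 3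
  have h3 : ((3 : ℕ).factorial : ℝ) = 6 := by norm_num [Nat.factorial]
  rw [h3] at h
  have hexp : u ^ 3 / 3072 ≤ Real.exp (u / 8) := by
    have : (u / 8) ^ 3 / 6 = u ^ 3 / 3072 := by ring
    linarith
  have hpoly : (1 + u) ^ 2 ≤ 4 * u ^ 2 := by nlinarith
  rw [Real.exp_neg]
  have hpos := Real.exp_pos (u / 8)
  rw [inv_mul_le_iff₀ hpos]
  calc (1 + u) ^ 2 ≤ 4 * u ^ 2 := hpoly
    _ = (u ^ 3 / 3072) * (12288 * u⁻¹) := by field_simp; ring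
    _ ≤ Real.exp (u / 8) * (12288 * u⁻¹) := mul_le_mul_of_nonneg_right hexp (by positivity)

/-- `log log N ≥ 1` for `N ≥ 16` (`log 16 = 4 log 2 > e`). [folklore] -/
theorem one_le_log_log_natCast {N : ℕ} (hN : 16 ≤ N) : 1 ≤ Real.log (Real.log N) := by
  have h2 := Real.log_two_gt_d9
  have he := Real.exp_one_lt_d9
  have h16 : (16 : ℝ) ≤ N := by exact_mod_cast hN
  have h4 : Real.log 16 = 4 * Real.log 2 := by
    rw [show (16 : ℝ) = 2 ^ 4 by norm_num, Real.log_pow]; norm_num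
  have hlog : Real.exp 1 ≤ Real.log N := by
    have := Real.log_le_log (by norm_num) h16
    linarith
  rw [← Real.log_exp 1]
  exact Real.log_le_log (Real.exp_pos 1) hlog

/-- **The rate inequalities behind "le choix `ε = 25(log log N)^{5/2+δ}(log N)^{-1/2}` donne le
théorème"** (with `25` replaced by any `A > 0`): for `N ≥ 16` and `p ≥ 0`, with `L = log N`,
`ε = A(log L)^p L^{-1/2}`: `ε > 0`, `N^{-ε/2}(1+L)³ ≤ (40320(2/A)⁷/A) ε` and `N^{-3/8} ≤ (12288/A) ε`.
[cite: BalazardDeRoton2010, Théorème 1 (proof, p. 3)] -/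
theorem rate_facts_of_sixteen_le {N : ℕ} (hN16 : 16 ≤ N) {A p : ℝ} (hA : 0 < A) (hp0 : 0 ≤ p) :
    0 < A * Real.log (Real.log N) ^ p * Real.log N ^ (-(1 / 2 : ℝ)) ∧
    (N : ℝ) ^ (-(A * Real.log (Real.log N) ^ p * Real.log N ^ (-(1 / 2 : ℝ))) / 2) * (1 + Real.log N) ^ 3 ≤
      (40320 * (2 / A) ^ 7 / A) * (A * Real.log (Real.log N) ^ p * Real.log N ^ (-(1 / 2 : ℝ))) ∧
    (N : ℝ) ^ (-(3 / 8 : ℝ)) ≤ (12288 / A) * (A * Real.log (Real.log N) ^ p * Real.log N ^ (-(1 / 2 : ℝ))) := by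
  have hNpos : (0 : ℝ) < N := by exact_mod_cast (show 0 < N by omega)
  have hN1 : (1 : ℝ) ≤ N := by exact_mod_cast (show 1 ≤ N by omega)
  set L : ℝ := Real.log N with hL
  have hLL : 1 ≤ Real.log L := one_le_log_log_natCast hN16
  have hL1 : 1 ≤ L := by
    have h2 := Real.log_two_gt_d9
    have h16 : Real.log 16 ≤ L := Real.log_le_log (by norm_num) (by exact_mod_cast hN16)
    have h4 : Real.log 16 = 4 * Real.log 2 := by
      rw [show (16 : ℝ) = 2 ^ 4 by norm_num, Real.log_pow]; norm_num
    linarith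
  have hLpos : 0 < L := by linarith
  set ε : ℝ := A * Real.log L ^ p * L ^ (-(1 / 2 : ℝ)) with hεdef
  have hlogLp : 1 ≤ Real.log L ^ p := Real.one_le_rpow hLL hp0
  have hLhalf : 0 < L ^ (-(1 / 2 : ℝ)) := Real.rpow_pos_of_pos hLpos _
  have hεge : A * L ^ (-(1 / 2 : ℝ)) ≤ ε := by
    rw [hεdef]
    have : A * L ^ (-(1 / 2 : ℝ)) ≤ A * L ^ (-(1 / 2 : ℝ)) * Real.log L ^ p :=
      le_mul_of_one_le_right (by positivity) hlogLp
    linarith [show A * L ^ (-(1 / 2 : ℝ)) * Real.log L ^ p = A * Real.log L ^ p * L ^ (-(1 / 2 : ℝ)) by ring]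
  have hεpos : 0 < ε := lt_of_lt_of_le (by positivity) hεge
  -- `L^{-1/2} ≤ ε/A`
  have hLε : L ^ (-(1 / 2 : ℝ)) ≤ ε / A := by
    rw [le_div_iff₀ hA]; linarith
  refine ⟨hεpos, ?_, ?_⟩
  · set x : ℝ := L ^ (1 / 2 : ℝ) with hx
    have hx1 : 1 ≤ x := Real.one_le_rpow hL1 (by norm_num)
    have hxpos : 0 < x := by linarith
    have hx2 : x ^ 2 = L := by
      rw [hx, ← Real.rpow_natCast, ← Real.rpow_mul hLpos.le]; norm_num
    have hxinv : x⁻¹ = L ^ (-(1 / 2 : ℝ)) := by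
      rw [hx, ← Real.rpow_neg_one, ← Real.rpow_mul hLpos.le]; norm_num
    have e2 : L ^ (-(1 / 2 : ℝ)) * L = x := by
      rw [hx]
      conv_lhs => rw [show L = L ^ (1 : ℝ) by rw [Real.rpow_one]]
      rw [← Real.rpow_mul hLpos.le, ← Real.rpow_add hLpos]; norm_num
    -- `(ε/2) L ≥ (A/2) x`
    have hεL : A / 2 * x ≤ ε / 2 * L := by
      have e1 : ε / 2 * L = A / 2 * (Real.log L ^ p * (L ^ (-(1 / 2 : ℝ)) * L)) := by rw [hεdef]; ring
      rw [e1, e2]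
      have : x ≤ Real.log L ^ p * x := le_mul_of_one_le_left hxpos.le hlogLp
      have hA2 : 0 ≤ A / 2 := by positivity
      nlinarith
    have hN : (N : ℝ) ^ (-ε / 2) = Real.exp (-(ε / 2 * L)) := by
      rw [Real.rpow_def_of_pos hNpos, ← hL]; congr 1; ring
    have hexp : Real.exp (-(ε / 2 * L)) ≤ Real.exp (-(A / 2 * x)) := Real.exp_le_exp.2 (by linarith)
    -- `exp(-(A/2)x)(1+x²)³ ≤ 40320 (2/A)⁷ / x`
    set y : ℝ := A / 2 * x with hy
    have hypos : 0 < y := by positivity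
    have hfac := Real.pow_div_factorial_le_exp y hypos.le 7
    have h7 : ((7 : ℕ).factorial : ℝ) = 5040 := by norm_num [Nat.factorial]
    rw [h7] at hfac
    have hpoly : (1 + x ^ 2) ^ 3 * x ≤ 8 * x ^ 7 := by
      have h1 : 1 + x ^ 2 ≤ 2 * x ^ 2 := by nlinarith
      have h2 : (1 + x ^ 2) ^ 3 ≤ (2 * x ^ 2) ^ 3 := pow_le_pow_left₀ (by positivity) h1 3
      nlinarith
    have hy7 : y ^ 7 = (A / 2) ^ 7 * x ^ 7 := by rw [hy]; ring
    have hkey : Real.exp (-y) * (1 + x ^ 2) ^ 3 * x ≤ 40320 * (2 / A) ^ 7 := by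
      rw [Real.exp_neg, mul_assoc, inv_mul_le_iff₀ (Real.exp_pos y)]
      have hA7 : 0 < (A / 2) ^ 7 := by positivity
      have e : Real.exp y * (40320 * (2 / A) ^ 7) = (Real.exp y * 5040 / (A / 2) ^ 7) * 8 := by
        field_simp; ring
      rw [e]
      have hge : (A / 2) ^ 7 * x ^ 7 / 5040 ≤ Real.exp y := by rw [← hy7]; exact hfac
      have hx7 : x ^ 7 ≤ Real.exp y * 5040 / (A / 2) ^ 7 := by
        rw [le_div_iff₀ hA7]; nlinarith
      nlinarith [pow_nonneg hxpos.le 7]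
    have h1 : Real.exp (-(A / 2 * x)) * (1 + L) ^ 3 ≤ 40320 * (2 / A) ^ 7 * x⁻¹ := by
      rw [← hy, ← hx2]
      have e : Real.exp (-y) * (1 + x ^ 2) ^ 3 = (Real.exp (-y) * (1 + x ^ 2) ^ 3 * x) * x⁻¹ := by field_simp
      rw [e]
      exact mul_le_mul_of_nonneg_right hkey (inv_nonneg.2 hxpos.le)
    rw [show (-(A * Real.log L ^ p * L ^ (-(1 / 2 : ℝ))) / 2) = -ε / 2 by rw [hεdef], hN]
    have hc0 : 0 ≤ 40320 * (2 / A) ^ 7 := by positivity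
    calc Real.exp (-(ε / 2 * L)) * (1 + L) ^ 3 ≤ Real.exp (-(A / 2 * x)) * (1 + L) ^ 3 :=
          mul_le_mul_of_nonneg_right hexp (by positivity)
      _ ≤ 40320 * (2 / A) ^ 7 * x⁻¹ := h1
      _ = 40320 * (2 / A) ^ 7 * L ^ (-(1 / 2 : ℝ)) := by rw [hxinv]
      _ ≤ 40320 * (2 / A) ^ 7 * (ε / A) := mul_le_mul_of_nonneg_left hLε hc0
      _ = (40320 * (2 / A) ^ 7 / A) * ε := by ring
  · have hN : (N : ℝ) ^ (-(1 / 8 : ℝ)) = Real.exp (-(L / 8)) := by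
      rw [Real.rpow_def_of_pos hNpos, ← hL]; congr 1; ring
    have h38 : (N : ℝ) ^ (-(3 / 8 : ℝ)) ≤ (N : ℝ) ^ (-(1 / 8 : ℝ)) :=
      Real.rpow_le_rpow_of_exponent_le hN1 (by norm_num)
    have hk := exp_neg_div_eight_mul_one_add_sq_le hL1
    have hinv : L⁻¹ ≤ L ^ (-(1 / 2 : ℝ)) := by
      rw [← Real.rpow_neg_one]
      exact Real.rpow_le_rpow_of_exponent_le hL1 (by norm_num)
    have hsq : 1 ≤ (1 + L) ^ 2 := by nlinarith
    calc (N : ℝ) ^ (-(3 / 8 : ℝ)) ≤ (N : ℝ) ^ (-(1 / 8 : ℝ)) := h38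
      _ ≤ (N : ℝ) ^ (-(1 / 8 : ℝ)) * (1 + L) ^ 2 := le_mul_of_one_le_right (Real.rpow_nonneg hNpos.le _) hsq
      _ = Real.exp (-(L / 8)) * (1 + L) ^ 2 := by rw [hN]
      _ ≤ 12288 * L⁻¹ := hk
      _ ≤ 12288 * L ^ (-(1 / 2 : ℝ)) := by gcongr
      _ ≤ 12288 * (ε / A) := by gcongr
      _ = (12288 / A) * ε := by ring

/-- The rate is positive for `N ≥ 3`. [folklore] -/
theorem rate_pos_of_three_le {N : ℕ} (hN : 3 ≤ N) (p : ℝ) :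
    0 < Real.log (Real.log N) ^ p * Real.log N ^ (-(1 / 2 : ℝ)) := by
  have he := Real.exp_one_lt_d9
  have h3 : (3 : ℝ) ≤ N := by exact_mod_cast hN
  have hlog : 1 < Real.log N := by
    rw [← Real.log_exp 1]
    exact Real.log_lt_log (Real.exp_pos 1) (by linarith)
  have hll : 0 < Real.log (Real.log N) := Real.log_pos hlog
  exact mul_pos (Real.rpow_pos_of_pos hll _) (Real.rpow_pos_of_pos (by linarith) _)

end BalazardDeRoton

open BalazardDeRoton BaezDuarteOnlyIf in
/-- **Balazard–de Roton 2010, Théorème 1, from their Proposition 10 alone.** Under RH, for every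
`δ > 0` there is `C` such that for all `N ≥ 3` some real combination of `{1/(nx)}`, `n ≤ N`, is
within squared `L²(0,∞)`-distance `C (log log N)^{5/2+δ}(log N)^{-1/2}` of `𝟙_{(0,1]}` — PROVIDED the
paper's Proposition 10 (under RH; §6, resting on Soundararajan's method, [S2008]/[BR2008]), taken as
the hypothesis `hP10` in the exact shape of `BalazardDeRoton.iBound_of_pointwise` (there a SECOND
hypothesis, Titchmarsh's (14.14.1), is required; here it is not). Proof: `d_N² ≤ π⁻¹(∫J + ∫I)` (Prop. 1,
`BalazardDeRoton.baezDuarteDistSqOf_coeff_le`), `∫J ≤ C₁ε` (Prop. 2,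
`BalazardDeRoton.exists_lintegral_jIntegrand_le`), `∫_{|τ|≥N^{3/4}}I ≤ C₁₃N^{-3/8}` (Prop. 13,
`BalazardDeRoton.exists_lintegral_iIntegrand_tail_le`), `∫_{|τ|<N^{3/4}}I ≤ C₀K²N^{-ε/2}log³N` (Prop. 14
from Prop. 10 and the mean square of `ζ`, `exists_lintegral_iIntegrand_small_le_of_pointwise`), with
`ε = A(log log N)^{5/2+δ'}(log N)^{-1/2}`, `δ' = min(δ, 1/2)`, and `rate_facts_of_sixteen_le`; for the
finitely many small `N`, the zero vector (`d_N² = 1`).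
[cite: BalazardDeRoton2010, Théorème 1 (proof, §2 and §7)] -/
theorem BalazardDeRoton2010_thm1_of_prop10
    (hP10 : RiemannHypothesis → ∀ δ : ℝ, 0 < δ → δ ≤ 1 / 2 → ∃ (A K : ℝ) (N₀ : ℕ), 0 < A ∧ 0 < K ∧
      ∀ N : ℕ, N₀ ≤ N → ∀ ε : ℝ,
        A * Real.log (Real.log (N : ℝ)) ^ (5 / 2 + δ) * Real.log (N : ℝ) ^ (-(1 / 2 : ℝ)) ≤ ε →
        ε ≤ 1 / 4 → ∀ τ : ℝ, |τ| ≤ (N : ℝ) ^ (3 / 4 : ℝ) →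
          ‖(riemannZeta (1 / 2 + ε + τ * I))⁻¹ - moebiusSum N (1 / 2 + ε + τ * I)‖ ≤
            K * (N : ℝ) ^ (-ε / 4) * (1 + |τ|) ^ (1 / 2 - betaExp τ)) :
    BalazardDeRoton2010_thm1 := by
  intro hRH δ hδ
  set δ' : ℝ := min δ (1 / 2) with hδ'
  have hδ'0 : 0 < δ' := lt_min hδ (by norm_num)
  have hδ'δ : δ' ≤ δ := min_le_left _ _
  have hδ'h : δ' ≤ 1 / 2 := min_le_right _ _
  obtain ⟨A, K, N₀, hA, hK, hP⟩ := hP10 hRH δ' hδ'0 hδ'h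
  obtain ⟨C₀, hC₀, hlow⟩ := exists_lintegral_iIntegrand_small_le_of_pointwise hRH
  obtain ⟨Ch, hCh, hhigh⟩ := exists_lintegral_iIntegrand_tail_le hRH
  obtain ⟨C_J, ε₁, hε₁, hJ⟩ := exists_lintegral_jIntegrand_le hRH
  set CJ : ℝ := max C_J 0 with hCJ
  set p : ℝ := 5 / 2 + δ' with hp
  have hp0 : 0 ≤ p := by rw [hp]; linarith
  set εf : ℕ → ℝ := fun N ↦ A * Real.log (Real.log N) ^ p * Real.log N ^ (-(1 / 2 : ℝ)) with hεf
  -- eventually `ε_N ≤ min ε₁ (1/4)`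
  obtain ⟨Ne, hNe⟩ : ∃ Ne : ℕ, ∀ N, Ne ≤ N → εf N ≤ min ε₁ (1 / 4) := by
    have h := (tendsto_order.1 (tendsto_loglog_rpow_mul_log_rpow A p)).2 (min ε₁ (1 / 4))
      (lt_min hε₁ (by norm_num))
    obtain ⟨Ne, hNe⟩ := eventually_atTop.1 h
    exact ⟨Ne, fun N hN ↦ (hNe N hN).le⟩
  set N₁ : ℕ := max (max N₀ 16) Ne with hN₁
  set K₀ : ℝ := CJ + C₀ * K ^ 2 * (40320 * (2 / A) ^ 7 / A) + Ch * (12288 / A) with hK₀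
  have hK₀0 : 0 ≤ K₀ := by positivity
  set K₁ : ℝ := π⁻¹ * K₀ * A with hK₁
  have hK₁0 : 0 ≤ K₁ := by positivity
  set RHS : ℕ → ℝ := fun N ↦ Real.log (Real.log N) ^ (5 / 2 + δ) * Real.log N ^ (-(1 / 2 : ℝ)) with hRHS
  set K₂ : ℝ := ∑ n ∈ Finset.range N₁, max 0 (RHS n)⁻¹ with hK₂
  have hK₂0 : 0 ≤ K₂ := Finset.sum_nonneg fun n _ ↦ le_max_left _ _
  refine ⟨K₁ + K₂, fun N hN3 ↦ ?_⟩
  have hRHSpos : 0 < RHS N := rate_pos_of_three_le hN3 _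
  rcases lt_or_ge N N₁ with hsmall | hlarge
  · -- small `N`: the zero vector
    refine ⟨fun _ ↦ 0, ?_⟩
    rw [baezDuarteDistSqOf_zero, ← ENNReal.ofReal_one]
    refine ENNReal.ofReal_le_ofReal ?_
    have h1 : (RHS N)⁻¹ ≤ K₂ := by
      have hmem : N ∈ Finset.range N₁ := Finset.mem_range.2 hsmall
      calc (RHS N)⁻¹ ≤ max 0 (RHS N)⁻¹ := le_max_right _ _
        _ ≤ ∑ n ∈ Finset.range N₁, max 0 (RHS n)⁻¹ :=
            Finset.single_le_sum (f := fun n ↦ max 0 (RHS n)⁻¹) (fun n _ ↦ le_max_left _ _) hmem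
    have h2 : 1 ≤ K₂ * RHS N := by
      calc (1 : ℝ) = (RHS N)⁻¹ * RHS N := (inv_mul_cancel₀ hRHSpos.ne').symm
        _ ≤ K₂ * RHS N := mul_le_mul_of_nonneg_right h1 hRHSpos.le
    have h3 : 0 ≤ K₁ * RHS N := by positivity
    calc (1 : ℝ) ≤ K₁ * RHS N + K₂ * RHS N := by linarith
      _ = (K₁ + K₂) * Real.log (Real.log N) ^ (5 / 2 + δ) * Real.log N ^ (-(1 / 2 : ℝ)) := by
          rw [hRHS]; ring
  · -- large `N`
    have hN₀ : N₀ ≤ N := le_trans (le_trans (le_max_left _ _) (le_max_left _ _)) hlarge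
    have hN16 : 16 ≤ N := le_trans (le_trans (le_max_right _ _) (le_max_left _ _)) hlarge
    have hNe' : Ne ≤ N := le_trans (le_max_right _ _) hlarge
    have hN1nat : 1 ≤ N := by omega
    have hNpos : (0 : ℝ) < N := by exact_mod_cast (show 0 < N by omega)
    obtain ⟨hεpos, hrate1, hrate2⟩ := rate_facts_of_sixteen_le hN16 hA hp0
    set ε : ℝ := εf N with hεdef
    have hεmin : ε ≤ min ε₁ (1 / 4) := hNe N hNe'
    have hεle : ε ≤ 1 / 4 := hεmin.trans (min_le_right _ _)
    have hεε₁ : ε ≤ ε₁ := hεmin.trans (min_le_left _ _)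
    have hLL : 1 ≤ Real.log (Real.log N) := one_le_log_log_natCast hN16
    have hlogN : 0 ≤ Real.log N := Real.log_nonneg (by exact_mod_cast hN1nat)
    -- the three integral bounds
    have hthr : A * Real.log (Real.log N) ^ (5 / 2 + δ') * Real.log N ^ (-(1 / 2 : ℝ)) ≤ ε := by
      rw [hεdef, hεf, hp]
    have hpt := hP N hN₀ ε hthr hεle
    have hlow' := hlow K hK.le N hN1nat ε hεpos hεle hpt
    have hhigh' := hhigh N hN1nat ε hεpos hεle
    have hJ' := hJ ε hεpos hεε₁
    set Xl : ℝ := C₀ * K ^ 2 * (N : ℝ) ^ (-ε / 2) * (1 + Real.log N) ^ 3 with hXl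
    set Xh : ℝ := Ch * (N : ℝ) ^ (-(3 / 8 : ℝ)) with hXh
    have hXl0 : 0 ≤ Xl := by rw [hXl]; positivity
    have hXh0 : 0 ≤ Xh := by rw [hXh]; positivity
    have hI : ∫⁻ τ, ENNReal.ofReal (iIntegrand N ε τ) ≤ ENNReal.ofReal Xl + ENNReal.ofReal Xh := by
      have hunion : (univ : Set ℝ) = {τ : ℝ | |τ| < (N : ℝ) ^ (3 / 4 : ℝ)} ∪
          {τ : ℝ | (N : ℝ) ^ (3 / 4 : ℝ) ≤ |τ|} := by
        ext τ; simp [lt_or_ge]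
      calc ∫⁻ τ, ENNReal.ofReal (iIntegrand N ε τ)
          = ∫⁻ τ in {τ : ℝ | |τ| < (N : ℝ) ^ (3 / 4 : ℝ)} ∪ {τ : ℝ | (N : ℝ) ^ (3 / 4 : ℝ) ≤ |τ|},
              ENNReal.ofReal (iIntegrand N ε τ) := by rw [← hunion, Measure.restrict_univ]
        _ ≤ (∫⁻ τ in {τ : ℝ | |τ| < (N : ℝ) ^ (3 / 4 : ℝ)}, ENNReal.ofReal (iIntegrand N ε τ)) +
              ∫⁻ τ in {τ : ℝ | (N : ℝ) ^ (3 / 4 : ℝ) ≤ |τ|}, ENNReal.ofReal (iIntegrand N ε τ) :=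
            lintegral_union_le _ _ _
        _ ≤ ENNReal.ofReal Xl + ENNReal.ofReal Xh := add_le_add hlow' hhigh'
    have hJCJ : ∫⁻ τ : ℝ, ENNReal.ofReal (jIntegrand ε τ) ≤ ENNReal.ofReal (CJ * ε) := by
      refine hJ'.trans (ENNReal.ofReal_le_ofReal ?_)
      exact mul_le_mul_of_nonneg_right (le_max_left _ _) hεpos.le
    -- Proposition 1 and the assembly
    have hP1 := baezDuarteDistSqOf_coeff_le N ε
    refine ⟨coeff (ε / 2) N, hP1.trans ?_⟩
    have hsum : (∫⁻ τ : ℝ, ENNReal.ofReal (jIntegrand ε τ)) + ∫⁻ τ : ℝ, ENNReal.ofReal (iIntegrand N ε τ) ≤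
        ENNReal.ofReal (CJ * ε + Xl + Xh) := by
      have hCJε : 0 ≤ CJ * ε := by positivity
      rw [ENNReal.ofReal_add (by positivity) hXh0, ENNReal.ofReal_add hCJε hXl0]
      calc (∫⁻ τ : ℝ, ENNReal.ofReal (jIntegrand ε τ)) + ∫⁻ τ : ℝ, ENNReal.ofReal (iIntegrand N ε τ)
          ≤ ENNReal.ofReal (CJ * ε) + (ENNReal.ofReal Xl + ENNReal.ofReal Xh) := add_le_add hJCJ hI
        _ = ENNReal.ofReal (CJ * ε) + ENNReal.ofReal Xl + ENNReal.ofReal Xh := (add_assoc _ _ _).symm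
    have hR : CJ * ε + Xl + Xh ≤ K₀ * ε := by
      have h1 : Xl ≤ C₀ * K ^ 2 * ((40320 * (2 / A) ^ 7 / A) * ε) := by
        rw [hXl, mul_assoc (C₀ * K ^ 2)]
        exact mul_le_mul_of_nonneg_left hrate1 (by positivity)
      have h2 : Xh ≤ Ch * ((12288 / A) * ε) := by
        rw [hXh]; exact mul_le_mul_of_nonneg_left hrate2 hCh.le
      rw [hK₀]; nlinarith
    have hpow : Real.log (Real.log N) ^ p ≤ Real.log (Real.log N) ^ (5 / 2 + δ) :=
      Real.rpow_le_rpow_of_exponent_le hLL (by rw [hp]; linarith)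
    have hL12 : 0 ≤ Real.log N ^ (-(1 / 2 : ℝ)) := Real.rpow_nonneg hlogN _
    calc ENNReal.ofReal π⁻¹ * ((∫⁻ τ : ℝ, ENNReal.ofReal (jIntegrand ε τ)) +
          ∫⁻ τ : ℝ, ENNReal.ofReal (iIntegrand N ε τ))
        ≤ ENNReal.ofReal π⁻¹ * ENNReal.ofReal (K₀ * ε) := by
          gcongr
          exact hsum.trans (ENNReal.ofReal_le_ofReal hR)
      _ = ENNReal.ofReal (π⁻¹ * (K₀ * ε)) := (ENNReal.ofReal_mul (by positivity)).symm
      _ ≤ ENNReal.ofReal ((K₁ + K₂) * Real.log (Real.log N) ^ (5 / 2 + δ) * Real.log N ^ (-(1 / 2 : ℝ))) := by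
          refine ENNReal.ofReal_le_ofReal ?_
          calc π⁻¹ * (K₀ * ε) = K₁ * Real.log (Real.log N) ^ p * Real.log N ^ (-(1 / 2 : ℝ)) := by
                rw [hK₁, hεdef, hεf]; simp only; ring
            _ ≤ K₁ * Real.log (Real.log N) ^ (5 / 2 + δ) * Real.log N ^ (-(1 / 2 : ℝ)) := by gcongr
            _ ≤ (K₁ + K₂) * Real.log (Real.log N) ^ (5 / 2 + δ) * Real.log N ^ (-(1 / 2 : ℝ)) := by
                have h0 : 0 ≤ Real.log (Real.log N) ^ (5 / 2 + δ) :=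
                  Real.rpow_nonneg (zero_le_one.trans hLL) _
                exact mul_le_mul_of_nonneg_right
                  (mul_le_mul_of_nonneg_right (le_add_of_nonneg_right hK₂0) h0) hL12

end Literature.NumberTheory.LFunctions

end
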